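import Literature.Analysis.Calculus.PeriodicDivergence
import Mathlib.Analysis.Calculus.BumpFunction.Convolution
import Mathlib.Analysis.Calculus.BumpFunction.FiniteDimension
import Mathlib.Analysis.Calculus.ParametricIntegral
import Mathlib.Analysis.Convolution
import HarnessLib

/-!
# `C¹` mollification and the degree integral of a `C¹` periodic map

Topic `Literature/Analysis/Calculus`. Two results:

* `hasFDerivAt_normed_convolution_of_contDiff`, `exists_contDiff_approx_fderiv` — mollification
  of a `C¹` map `f : E → F` (finite-dimensional real `E`, complete `F`) by a normalised smooth
  bump `φ`: `D(φ ⋆ f) = φ ⋆ Df` (differentiation under the integral sign), hence on every compact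
  set `K` and for every `ε > 0` there is a `C^∞` map `g` with `‖g - f‖ ≤ ε` and `‖Dg - Df‖ ≤ ε`
  on `K`, which moreover inherits every translation symmetry of `f` (Evans, *PDE*, App. C.4,
  Thm. 7 (properties of mollifiers); Hirsch, *Differential Topology*, Ch. 2 Thm. 2.3 /
  convolution approximation in the `C¹` topology).
* `integral_divG_comp_mul_det_eq_zero` — the `C¹` version of
  `integral_divG_comp_mul_det_eq_zero_of_contDiff` (`PeriodicDivergence.lean`): for a `C¹`
  coordinatewise `T`-periodic `f : ℝⁿ⁺¹ → ℝⁿ⁺¹`, a differentiable field `G` with continuous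
  divergence `ψ`, `∫_{[a,a+T]} ψ(f x) det Df(x) dx = 0`. Proof: the `C²` statement applied to the
  periodic mollifications `g → f` (`C¹`-uniformly on the box), and uniform continuity of
  `(v, A) ↦ ψ(v) det A` on a compact neighbourhood of `{(f x, Df x)}` (Chang, *Methods in
  Nonlinear Analysis* (2005), §3.1, step III "extension to continuous mappings", here only to `C¹`).

Used by `Literature/Topology/Euclidean/PoincareHopfTorus.lean`. No definitions, no `sorry`.

## References

* K.-C. Chang, *Methods in Nonlinear Analysis* (2005), §3.1. [Chang2005]
* L. C. Evans, *Partial Differential Equations*, 2nd ed. (2010), App. C.4 Thm. 7. [Evans2010]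
-/

noncomputable section

open MeasureTheory Set Function Metric Filter
open scoped Convolution ContDiff Topology

namespace Literature.Analysis.Calculus

section Mollify

variable {E : Type*} [NormedAddCommGroup E] [NormedSpace ℝ E] [FiniteDimensional ℝ E]
  [MeasurableSpace E] [BorelSpace E]
  {F : Type*} [NormedAddCommGroup F] [NormedSpace ℝ F] [CompleteSpace F]

omit [CompleteSpace F] in
/-- **Derivative of a mollification falls on the smooth factor's partner**: for a `C¹` map `f`
and a normalised bump `φ`, `D(φ ⋆ f)(x) = (φ ⋆ Df)(x) = ∫ φ(t) Df(x - t) dt` (differentiation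
under the integral sign, the derivative `Df` being bounded on compact sets; Evans, *PDE*, App. C.4,
Thm. 7). [folklore] -/
theorem hasFDerivAt_normed_convolution_of_contDiff (φ : ContDiffBump (0 : E)) (μ : Measure E)
    [μ.IsAddHaarMeasure] {f : E → F} (hf : ContDiff ℝ 1 f) (x₀ : E) :
    HasFDerivAt (φ.normed μ ⋆[ContinuousLinearMap.lsmul ℝ ℝ, μ] f)
      ((φ.normed μ ⋆[ContinuousLinearMap.lsmul ℝ ℝ, μ] fderiv ℝ f) x₀) x₀ := by
  have hfd : Differentiable ℝ f := hf.differentiable one_ne_zero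
  have hfc : Continuous (fderiv ℝ f) := hf.continuous_fderiv one_ne_zero
  -- a bound for `Df` on the compact set `closedBall x₀ (1 + rOut)`
  obtain ⟨C, hC⟩ := (isCompact_closedBall x₀ (1 + φ.rOut)).exists_bound_of_continuousOn
    hfc.continuousOn
  have key := hasFDerivAt_integral_of_dominated_of_fderiv_le (μ := μ)
    (F := fun x t => φ.normed μ t • f (x - t))
    (F' := fun x t => φ.normed μ t • fderiv ℝ f (x - t))
    (bound := fun t => C * ‖φ.normed μ t‖) (ball_mem_nhds x₀ one_pos) ?_ ?_ ?_ ?_ ?_ ?_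
  · have h1 : (φ.normed μ ⋆[ContinuousLinearMap.lsmul ℝ ℝ, μ] f) =
        fun x => ∫ t, φ.normed μ t • f (x - t) ∂μ := rfl
    rw [h1, convolution_lsmul]
    exact key
  · exact Eventually.of_forall fun x =>
      (φ.continuous_normed.smul (hf.continuous.comp (continuous_const.sub continuous_id)))
        |>.aestronglyMeasurable
  · apply Continuous.integrable_of_hasCompactSupport
    · exact φ.continuous_normed.smul (hf.continuous.comp (continuous_const.sub continuous_id))
    · exact φ.hasCompactSupport_normed.smul_right
  · exact (φ.continuous_normed.smul (hfc.comp (continuous_const.sub continuous_id)))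
      |>.aestronglyMeasurable
  · refine Eventually.of_forall fun t x hx => ?_
    by_cases ht : φ.normed μ t = 0
    · simp [ht]
    · have ht' : t ∈ Function.support (φ.normed μ) := ht
      rw [φ.support_normed_eq, mem_ball, dist_zero_right] at ht'
      have hxt : x - t ∈ closedBall x₀ (1 + φ.rOut) := by
        rw [mem_closedBall, dist_eq_norm]
        calc ‖x - t - x₀‖ = ‖(x - x₀) - t‖ := by abel_nf
          _ ≤ ‖x - x₀‖ + ‖t‖ := norm_sub_le _ _
          _ ≤ 1 + φ.rOut := by
            have := mem_ball_iff_norm.1 hx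
            linarith
      calc ‖φ.normed μ t • fderiv ℝ f (x - t)‖ = ‖φ.normed μ t‖ * ‖fderiv ℝ f (x - t)‖ :=
            norm_smul _ _
        _ ≤ ‖φ.normed μ t‖ * C := by gcongr; exact hC _ hxt
        _ = C * ‖φ.normed μ t‖ := mul_comm _ _
  · exact (φ.integrable_normed.norm).const_mul C
  · refine Eventually.of_forall fun t x _ => ?_
    have h1 : HasFDerivAt (fun x => f (x - t)) (fderiv ℝ f (x - t)) x := by
      have h := ((hfd (x - t)).hasFDerivAt).comp x (hasFDerivAt_sub_const t)
      simpa [Function.comp_def] using h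
    exact h1.const_smul (φ.normed μ t)

omit [BorelSpace E] [CompleteSpace F] in
/-- A mollification inherits the translation symmetries of the mollified map. [folklore] -/
theorem normed_convolution_add_of_forall_add (φ : ContDiffBump (0 : E)) (μ : Measure E)
    {f : E → F} {v : E} (hv : ∀ x, f (x + v) = f x) (x : E) :
    (φ.normed μ ⋆[ContinuousLinearMap.lsmul ℝ ℝ, μ] f) (x + v) =
      (φ.normed μ ⋆[ContinuousLinearMap.lsmul ℝ ℝ, μ] f) x := by
  simp only [convolution_lsmul]
  congr 1
  funext t
  rw [add_sub_right_comm, hv]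

/-- **`C¹` approximation by smooth maps on compact sets, respecting translation symmetries.**
If `f : E → F` is `C¹` (finite-dimensional `E`, complete `F`), `K ⊆ E` is compact and `ε > 0`,
there is a `C^∞` map `g` with `‖g x - f x‖ ≤ ε` and `‖Dg x - Df x‖ ≤ ε` for all `x ∈ K`, and
with `g (x + v) = g x` for all `x` whenever `f (x + v) = f x` for all `x`: take `g = φ ⋆ f` for a
normalised bump of radius below the `ε`-uniform-continuity moduli of `f` and `Df` on the compact
`1`-thickening of `K` (`ContDiffBump.dist_normed_convolution_le`,
`hasFDerivAt_normed_convolution_of_contDiff`). (Hirsch, *Differential Topology*, Thm. 2.2.3-type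
statement; Evans App. C.4 Thm. 7.) [folklore] -/
theorem exists_contDiff_approx_fderiv {f : E → F} (hf : ContDiff ℝ 1 f) {K : Set E}
    (hK : IsCompact K) {ε : ℝ} (hε : 0 < ε) :
    ∃ g : E → F, ContDiff ℝ ∞ g ∧
      (∀ v : E, (∀ x, f (x + v) = f x) → ∀ x, g (x + v) = g x) ∧
      (∀ x ∈ K, ‖g x - f x‖ ≤ ε) ∧ ∀ x ∈ K, ‖fderiv ℝ g x - fderiv ℝ f x‖ ≤ ε := by
  borelize E
  set μ : Measure E := Measure.addHaar
  have hfc1 : Continuous (fderiv ℝ f) := hf.continuous_fderiv one_ne_zero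
  have hK' : IsCompact (cthickening 1 K) := hK.cthickening
  obtain ⟨δ₁, hδ₁, hδ₁f⟩ := Metric.uniformContinuousOn_iff.mp
    (hK'.uniformContinuousOn_of_continuous hf.continuous.continuousOn) ε hε
  obtain ⟨δ₂, hδ₂, hδ₂f⟩ := Metric.uniformContinuousOn_iff.mp
    (hK'.uniformContinuousOn_of_continuous hfc1.continuousOn) ε hε
  set δ' : ℝ := min (min δ₁ δ₂) 1 with hδ'
  have hδ'pos : 0 < δ' := lt_min (lt_min hδ₁ hδ₂) one_pos
  have hδ'1 : δ' ≤ 1 := min_le_right _ _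
  have hδ'δ₁ : δ' ≤ δ₁ := (min_le_left _ _).trans (min_le_left _ _)
  have hδ'δ₂ : δ' ≤ δ₂ := (min_le_left _ _).trans (min_le_right _ _)
  let φ : ContDiffBump (0 : E) := ⟨δ' / 4, δ' / 2, by positivity, by linarith⟩
  refine ⟨φ.normed μ ⋆[ContinuousLinearMap.lsmul ℝ ℝ, μ] f, ?_, ?_, ?_, ?_⟩
  · exact φ.hasCompactSupport_normed.contDiff_convolution_left _ φ.contDiff_normed
      hf.continuous.locallyIntegrable
  · intro v hv x
    exact normed_convolution_add_of_forall_add φ μ hv x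
  · intro x hx
    rw [← dist_eq_norm]
    apply ContDiffBump.dist_normed_convolution_le hf.continuous.aestronglyMeasurable
    intro y hy
    have hyx : dist y x < δ' / 2 := hy
    have hy' : y ∈ cthickening 1 K :=
      Metric.mem_cthickening_of_dist_le y x 1 K hx (by linarith)
    exact (hδ₁f y hy' x (self_subset_cthickening K hx) (by linarith)).le
  · intro x hx
    rw [(hasFDerivAt_normed_convolution_of_contDiff φ μ hf x).fderiv, ← dist_eq_norm]
    apply ContDiffBump.dist_normed_convolution_le hfc1.aestronglyMeasurable
    intro y hy
    have hyx : dist y x < δ' / 2 := hy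
    have hy' : y ∈ cthickening 1 K :=
      Metric.mem_cthickening_of_dist_le y x 1 K hx (by linarith)
    exact (hδ₂f y hy' x (self_subset_cthickening K hx) (by linarith)).le

end Mollify

/-! ### The degree integral of a `C¹` periodic map against a divergence vanishes -/

variable {n : ℕ}

/-- **`∫_K (div G)(f) det Df = 0` for `C¹` periodic `f`.** Let `f : ℝⁿ⁺¹ → ℝⁿ⁺¹` be `C¹` and
`T`-periodic in each coordinate (`T ≥ 0`), `G` differentiable with continuous divergence
`ψ = ∑ᵢ ∂ᵢ Gᵢ`. Then `∫_{[a, a+T]} ψ(f x) · det Df(x) dx = 0`. Proof: for the smooth periodic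
mollifications `g` of `f` the integral vanishes (`integral_divG_comp_mul_det_eq_zero_of_contDiff`),
and `ψ(g) det Dg → ψ(f) det Df` uniformly on the box as `g → f` in `C¹` there, by uniform
continuity of `(v, A) ↦ ψ(v) det A` on a compact neighbourhood of `{(f x, Df x) : x ∈ K}`
(Chang 2005, §3.1, Thm. 3.1.4 and step III). [cite: Chang2005, §3.1 Thm 3.1.4] -/
theorem integral_divG_comp_mul_det_eq_zero {T : ℝ} (hT : 0 ≤ T) (a : Fin (n + 1) → ℝ)
    {f : (Fin (n + 1) → ℝ) → Fin (n + 1) → ℝ} (hf : ContDiff ℝ 1 f)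
    (hper : ∀ x i, f (x + Pi.single i T) = f x)
    {G : (Fin (n + 1) → ℝ) → Fin (n + 1) → ℝ} (hG : Differentiable ℝ G)
    {ψ : (Fin (n + 1) → ℝ) → ℝ} (hψ : Continuous ψ)
    (hGψ : ∀ v, ∑ i, fderiv ℝ G v (Pi.single i 1) i = ψ v) :
    ∫ x in Icc a (fun i => a i + T), ψ (f x) * (fderiv ℝ f x).det = 0 := by
  set K : Set (Fin (n + 1) → ℝ) := Icc a (fun i => a i + T) with hK
  have hKc : IsCompact K := isCompact_Icc
  have hfc1 : Continuous (fderiv ℝ f) := hf.continuous_fderiv one_ne_zero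
  -- the integrand of `f` and its integrability
  have hIf : Continuous fun x => ψ (f x) * (fderiv ℝ f x).det :=
    (hψ.comp hf.continuous).mul (ContinuousLinearMap.continuous_det.comp hfc1)
  -- the continuous function `Φ (v, A) = ψ v * det A` and the compact set of values
  set Φ : (Fin (n + 1) → ℝ) × ((Fin (n + 1) → ℝ) →L[ℝ] Fin (n + 1) → ℝ) → ℝ :=
    fun p => ψ p.1 * p.2.det with hΦ
  have hΦc : Continuous Φ :=
    (hψ.comp continuous_fst).mul (ContinuousLinearMap.continuous_det.comp continuous_snd)
  set C := (fun x => (f x, fderiv ℝ f x)) '' K with hC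
  have hCc : IsCompact C := hKc.image (hf.continuous.prodMk hfc1)
  have hC₁ : IsCompact (cthickening 1 C) := hCc.cthickening
  -- main estimate: `‖∫_K ψ(f) det Df‖ ≤ η vol K` for every `η > 0`
  have hest : ∀ η : ℝ, 0 < η →
      ‖∫ x in K, ψ (f x) * (fderiv ℝ f x).det‖ ≤ η * volume.real K := by
    intro η hη
    obtain ⟨δ₁, hδ₁, hδ₁Φ⟩ := Metric.uniformContinuousOn_iff.mp
      (hC₁.uniformContinuousOn_of_continuous hΦc.continuousOn) η hη
    obtain ⟨g, hg, hgper, hg0, hg1⟩ := exists_contDiff_approx_fderiv hf hKc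
      (lt_min (half_pos hδ₁) one_half_pos)
    have hg2 : ContDiff ℝ 2 g := contDiff_infty.1 hg 2
    have hgperT : ∀ x i, g (x + Pi.single i T) = g x := fun x i =>
      hgper (Pi.single i T) (fun y => hper y i) x
    have hIg0 : ∫ x in K, ψ (g x) * (fderiv ℝ g x).det = 0 :=
      integral_divG_comp_mul_det_eq_zero_of_contDiff hT a hg2 hgperT hG hψ hGψ
    have hgc1 : Continuous (fderiv ℝ g) := hg.continuous_fderiv (by simp)
    have hIg : Continuous fun x => ψ (g x) * (fderiv ℝ g x).det :=
      (hψ.comp hg.continuous).mul (ContinuousLinearMap.continuous_det.comp hgc1)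
    -- pointwise closeness of the integrands on `K`
    have hclose : ∀ x ∈ K,
        ‖ψ (f x) * (fderiv ℝ f x).det - ψ (g x) * (fderiv ℝ g x).det‖ ≤ η := by
      intro x hx
      have hp : (f x, fderiv ℝ f x) ∈ C := ⟨x, hx, rfl⟩
      have hdist : dist (g x, fderiv ℝ g x) (f x, fderiv ℝ f x) < min (δ₁ / 2) (1 / 2) + δ₁ / 4 := by
        rw [Prod.dist_eq, dist_eq_norm, dist_eq_norm]
        have := max_le (hg0 x hx) (hg1 x hx)
        linarith
      have hq : (g x, fderiv ℝ g x) ∈ cthickening 1 C :=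
        Metric.mem_cthickening_of_dist_le _ _ 1 C hp (by
          have h1 : min (δ₁ / 2) (1 / 2 : ℝ) ≤ 1 / 2 := min_le_right _ _
          rw [Prod.dist_eq, dist_eq_norm, dist_eq_norm]
          have := max_le (hg0 x hx) (hg1 x hx)
          linarith)
      have hlt : dist (g x, fderiv ℝ g x) (f x, fderiv ℝ f x) < δ₁ := by
        have h1 : min (δ₁ / 2) (1 / 2 : ℝ) ≤ δ₁ / 2 := min_le_left _ _
        linarith
      have := hδ₁Φ _ hq _ (self_subset_cthickening C hp) hlt
      rw [dist_eq_norm] at this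
      simpa [Φ, norm_sub_rev] using this.le
    have hKfin : volume K < ⊤ := hKc.measure_lt_top
    calc ‖∫ x in K, ψ (f x) * (fderiv ℝ f x).det‖
        = ‖(∫ x in K, ψ (f x) * (fderiv ℝ f x).det) - ∫ x in K, ψ (g x) * (fderiv ℝ g x).det‖ := by
          rw [hIg0, sub_zero]
      _ = ‖∫ x in K, (ψ (f x) * (fderiv ℝ f x).det - ψ (g x) * (fderiv ℝ g x).det)‖ := by
          rw [← integral_sub (hIf.continuousOn.integrableOn_compact hKc)
            (hIg.continuousOn.integrableOn_compact hKc)]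
      _ ≤ η * volume.real K := norm_setIntegral_le_of_norm_le_const hKfin hclose
  -- conclusion
  have hfin : ‖∫ x in K, ψ (f x) * (fderiv ℝ f x).det‖ ≤ 0 := by
    rcases (measureReal_nonneg : 0 ≤ volume.real K).eq_or_lt with h0 | hpos
    · simpa [← h0] using hest 1 one_pos
    · refine le_of_forall_pos_le_add fun ε hε => ?_
      have := hest (ε / volume.real K) (div_pos hε hpos)
      rw [div_mul_cancel₀ _ hpos.ne'] at this
      linarith
  exact norm_le_zero_iff.mp hfin

end Literature.Analysis.Calculus
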